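import Mathlib.Tactic.Linarith
import Mathlib.Tactic.NormNum
import Mathlib.Tactic.Ring
import Mathlib.Tactic.LinearCombination
import HarnessLib

/-!
# The (0,1) cell of the ι-window, XXXI-B: the product ground `B₁ × B₂`, XVIII (ADDENDUM 1) — THE CORNER II, (R-rib-E): divisorial ribbon halves
# (report [XXXI] `H2-ZERO-ONE-31.md` §12): arithmetic shadows

Family `hodge`, b2b cell `hweil` (helper of item stmt-HodgeConjecture-2524). Companion (`pg18a_*`) of `WeilTypeLadderH2ProductGroundEighteen.lean`
(same seat). Report `run/shared/lean/b2b/hodge-weil/b2b-hweil-pv1-g43/H2-ZERO-ONE-31.md` ([XXXI]) §12 (ADDENDUM 1: the DIVISORIAL ribbon halves of the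
corner `(2Θ_{κ₁}, 2Θ_{κ₂})` — pieces `G[x] = (d₁,n₁)`, `Ḡ = (d₂,n₂)` line bundles on `V`, cosupport divisor `E`, `(e₁,e₂) = (d₁−d₂+2, n₁−n₂)` —:
LEMMA PAR-E, PROPOSITION S-VOID, the factorisation of the (E-rib, red-bundle) class equation into families I/II, THEOREM RIB-4B∞ (no four-piece
line-bundle design has a ribbon half, all designs), and the (E-rib, rib) sieve). HONEST FRAMING: census results inside the ladder's H2 test ((0,1) cell)
on the SPECIAL fourfold `X₀ = B₁ × B₂`; nothing here is a rung; no case of the Hodge conjecture is proved; no statement of [Markman 2025] / [Perry 2026] /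
[EdGFS 2025] is used. Every theorem is a def-free arithmetic statement that the report cites at the step named in its docstring; none claims geometry.
-/

-- mandated namespace `Summit.HodgeConjecture.HodgeConjecture.…` (Problem = Summit) trips `linter.dupNamespace`; the lakefile disables it
-- tree-wide (weak option), restated here so stand-alone elaboration is warning-free too.
set_option linter.dupNamespace false

namespace Summit.HodgeConjecture.HodgeConjecture.WeilTypeLadder

section ProductGroundEighteenAdd1

/-- **[XXXI] 12.2 LEMMA PAR-E (the local index of a divisorial ribbon half).** With pieces `G[x] = L₁`, `Ḡ = L₂` (line bundles on `V`, fibre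
characters `c₁, c₂ = ±1` at a half-period `p`) and `L₁ ≅ L₂(−V)(E)` equivariantly (`x` odd, `𝒪(E)` linearised so that `s_E` is invariant), one has
`c₁ = −π·c₂` with `π = ±1` the parity of the local equation of `E` at `p` (`+1` if `p ∉ E`), hence `t_p(G) = 2c₁ + 2c₂ = 2c₂(1 − π) ∈ {0, 4c₂}`:
**balanced at `p` iff `π = +1`.** [case split] -/
theorem pg18a_parE :
    ∀ c π : ℤ, (c = 1 ∨ c = -1) → (π = 1 ∨ π = -1) →
      (2 * (-π * c) + 2 * c = 2 * c * (1 - π)) ∧ (2 * c * (1 - π) = 0 ↔ π = 1) ∧ (π = -1 → 2 * c * (1 - π) = 4 * c) := by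
  intro c π hc hπ
  refine ⟨by ring, ?_, fun h => by subst h; ring⟩
  rcases hc with rfl | rfl <;> rcases hπ with rfl | rfl <;> norm_num

/-- **[XXXI] 12.4 (the (E-rib, red-bundle) class equation FACTORS).** For a divisorial ribbon V-half with box pieces `(d₁, n₁) = G[x]`, `(d₂, n₂) = Ḡ`,
`d₁ + d₂ = 4`, against a rank-2 vector bundle on `H` (`n′ = 2 − n₁ − n₂`, `m′ = n₁² + n₂² + n′²`, `μ′ = 3n′ + n₁(d₁−1) + n₂(d₂−1)`), the top-degree equation
`P := n₁²(d₁−2) + n₂²(d₂−2) − n′(n₁(d₁−1) + n₂(d₂−1)) − n′² + 2 = 0` satisfies **`P = 2(σ − 1)((d₁ − 2)δ + 1)`**, `σ = n₁ + n₂`, `δ = n₁ − n₂`. So the solutions are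
FAMILY II (`σ = 1`, i.e. `n′ = 1`, any `d₁`) and FAMILY I (`(d₁ − 2)δ = −1`, i.e. with `δ ≥ 0`: `d₁ = 1`, `δ = 1`). [`ring`; `Int.eq_one_of_mul_eq_one_right`] -/
theorem pg18a_factor :
    (∀ d₁ n₁ n₂ : ℤ,
      n₁ ^ 2 * (d₁ - 2) + n₂ ^ 2 * ((4 - d₁) - 2) - (2 - n₁ - n₂) * (n₁ * (d₁ - 1) + n₂ * ((4 - d₁) - 1)) - (2 - n₁ - n₂) ^ 2 + 2
        = 2 * ((n₁ + n₂) - 1) * ((d₁ - 2) * (n₁ - n₂) + 1)) ∧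
    (∀ d δ : ℤ, 0 ≤ δ → (d - 2) * δ + 1 = 0 → d = 1 ∧ δ = 1) := by
  refine ⟨fun d₁ n₁ n₂ => by ring, fun d δ hδ h => ?_⟩
  have h1 : δ * (2 - d) = 1 := by linarith
  have hδ1 : δ = 1 := Int.eq_one_of_mul_eq_one_right hδ h1
  subst hδ1
  constructor <;> linarith

/-- **[XXXI] 12.4 (families I and II, the numbers).** Family I: pieces `(1, n+1)`, `(3, n)` (`e₁ = 0`, `e₂ = 1`: cosupport `E = S`), `n′ = 1 − 2n`,
`m′ = (n+1)² + n² + n′²`; family II: pieces `(d₁, n₁)`, `(4 − d₁, 1 − n₁)`, `n′ = 1`, `(e₁, e₂) = (2d₁ − 2, 2n₁ − 1)`, `m′ = n₁² + (1−n₁)² + 1`. NO two-box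
(red) H-half `N₃ ⊠ λ₃ ⊕ N₄ ⊠ λ₄` (`n′ = n₃ + n₄`, `m′ = 2n₃n₄`) matches either family — THEOREM RIB-4B∞'s (E-rib, red two-box) half:
family II since `n₃ + n₄ = 1` forces `n₃n₄ ≤ 0`, family I since `8n₃n₄ ≤ 2(n₃+n₄)²`. [`ring` / `nlinarith`] -/
theorem pg18a_families :
    (∀ n : ℤ, 2 - (n + 1) - n = 1 - 2 * n ∧ (1:ℤ) - 3 + 2 = 0 ∧ (n + 1) - n = 1) ∧
    (∀ d₁ n₁ : ℤ, 2 - n₁ - (1 - n₁) = 1 ∧ d₁ - (4 - d₁) + 2 = 2 * d₁ - 2 ∧ n₁ - (1 - n₁) = 2 * n₁ - 1) ∧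
    (∀ n₁ n₃ n₄ : ℤ, n₃ + n₄ = 1 → 2 * n₃ * n₄ ≠ n₁ ^ 2 + (1 - n₁) ^ 2 + 1) ∧
    (∀ n n₃ n₄ : ℤ, n₃ + n₄ = 1 - 2 * n → 2 * n₃ * n₄ ≠ (n + 1) ^ 2 + n ^ 2 + (1 - 2 * n) ^ 2) := by
  refine ⟨fun n => ⟨by ring, by norm_num, by ring⟩, fun d₁ n₁ => ⟨by ring, by ring, by ring⟩, fun n₁ n₃ n₄ h hc => ?_, fun n n₃ n₄ h hc => ?_⟩
  · have h4 : n₄ = 1 - n₃ := by linarith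
    subst h4
    nlinarith [sq_nonneg n₁, sq_nonneg (1 - n₁), sq_nonneg (2 * n₃ - 1)]
  · have h4 : n₄ = 1 - 2 * n - n₃ := by linarith
    subst h4
    nlinarith [sq_nonneg (n + 1), sq_nonneg n, sq_nonneg (2 * n₃ - (1 - 2 * n))]

/-- **[XXXI] 12.5 THEOREM RIB-4B∞, (E-rib, E-rib) half: NO four-piece line-bundle design has ribbon halves on BOTH sides — all designs.** In the variables
`σ = n₁ + n₂`, `δ = n₁ − n₂ ≥ 0` (`(d₁,n₁) = G[x]`, `d₁ ≥ 1`), `σ′ = n₃ + n₄ = 2 − σ`, `δ′ = n₃ − n₄ ≥ 0` (`d₃ ≥ 1`), [XXX] 5.3's equations ×2 read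
(E3a) `2σ + 2(d₁−2)δ + σ′² + δ′² = 0`, (E3b) `σ² + δ² + 2σ′ + 2(d₃−2)δ′ = 0`, (E4) `σ² + δ² + 2(d₁−2)σδ + σ′² + δ′² + 2(d₃−2)σ′δ′ = −4`. Then: `d₁, d₃ ≥ 2` is
impossible (`σ ≤ 0`, `σ′ ≤ 0`, `σ + σ′ = 2`); `d₁ = d₃ = 1` is impossible ((E4) becomes `(σ−δ)² + (σ′−δ′)² = −4`); `d₁ = 1, d₃ ≥ 2` is impossible
(then `σ′ ≤ 0`, `σ ≥ 2`, and (E4) − σ′·(E3b) is a sum of non-negative terms `= −4`); symmetrically `d₁ ≥ 2, d₃ = 1`. [`nlinarith`] -/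
theorem pg18a_EE_empty :
    (∀ σ δ σ' δ' d₁ d₃ : ℤ, 2 ≤ d₁ → 2 ≤ d₃ → 0 ≤ δ → 0 ≤ δ' → σ + σ' = 2 →
        2 * σ + 2 * (d₁ - 2) * δ + σ' ^ 2 + δ' ^ 2 = 0 → σ ^ 2 + δ ^ 2 + 2 * σ' + 2 * (d₃ - 2) * δ' = 0 → False) ∧
    (∀ σ δ σ' δ' : ℤ, (σ - δ) ^ 2 + (σ' - δ') ^ 2 ≠ -4) ∧
    (∀ σ δ σ' δ' d₃ : ℤ, 2 ≤ d₃ → 0 ≤ δ → 0 ≤ δ' → σ + σ' = 2 →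
        2 * σ - 2 * δ + σ' ^ 2 + δ' ^ 2 = 0 → σ ^ 2 + δ ^ 2 + 2 * σ' + 2 * (d₃ - 2) * δ' = 0 →
        (σ - δ) ^ 2 + σ' ^ 2 + δ' ^ 2 + 2 * (d₃ - 2) * σ' * δ' ≠ -4) := by
  refine ⟨fun σ δ σ' δ' d₁ d₃ hd₁ hd₃ hδ hδ' hs h1 h2 => ?_, fun σ δ σ' δ' h => ?_, fun σ δ σ' δ' d₃ hd₃ hδ hδ' hs h1 h2 h3 => ?_⟩
  · have hA : 0 ≤ (d₁ - 2) * δ := mul_nonneg (by linarith) hδ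
    have hB : 0 ≤ (d₃ - 2) * δ' := mul_nonneg (by linarith) hδ'
    nlinarith [sq_nonneg σ', sq_nonneg δ', sq_nonneg σ, sq_nonneg δ]
  · nlinarith [sq_nonneg (σ - δ), sq_nonneg (σ' - δ')]
  · -- s := -σ' ≥ 0 from (E3b); σ = 2 + s; then (E4) - σ'·(E3b): (σ-δ)² + δ'² - σ'² - σ'σ² - σ'δ² = -4, impossible
    have hB : 0 ≤ (d₃ - 2) * δ' := mul_nonneg (by linarith) hδ'
    have hs' : σ' ≤ 0 := by nlinarith [sq_nonneg σ, sq_nonneg δ]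
    have hσ : σ = 2 - σ' := by linarith
    have key : (σ - δ) ^ 2 + δ' ^ 2 - σ' ^ 2 - σ' * σ ^ 2 - σ' * δ ^ 2 = -4 := by
      have h2' : 2 * (d₃ - 2) * δ' = -2 * σ' - σ ^ 2 - δ ^ 2 := by linarith
      have h3' : (σ - δ) ^ 2 + σ' ^ 2 + δ' ^ 2 + σ' * (2 * (d₃ - 2) * δ') = -4 := by linarith
      rw [h2'] at h3'
      linarith
    subst hσ
    nlinarith [sq_nonneg (2 - σ' - δ), sq_nonneg δ', mul_nonneg (neg_nonneg.mpr hs') (sq_nonneg σ'),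
      mul_nonneg (neg_nonneg.mpr hs') (sq_nonneg δ), mul_nonneg (neg_nonneg.mpr hs') (neg_nonneg.mpr hs'),
      mul_nonneg (mul_nonneg (neg_nonneg.mpr hs') (neg_nonneg.mpr hs')) (neg_nonneg.mpr hs')]

/-- **[XXXI] 12.6 (the (E-rib, rib) sieve is finite).** With `σ = 2 − 2n′` and `δ = 2m` even, `a′ = n₁² + n₂² + 2n′ = 2(1 − n′)² + 2m² + 2n′ ≤ 96` forces
`−6 ≤ n′ ≤ 7` and `m² ≤ 47` (so `|δ| ≤ 12`); with `b′ ≤ 16` and `δ ≥ 2` also `(d₁ − 2)δ ≤ 16 − σ − 2n′²`, bounding `d₁`; for `δ = 0` the numerics do not depend on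
`d₁`. Hence the machine search of `ribbon_sieve_E.py` PART I (`n′ ∈ [−40,40]`, `d₁ ≤ 39`, `δ ≤ 78`) is exhaustive. [`nlinarith`] -/
theorem pg18a_PI_bounds :
    (∀ n' m : ℤ, 2 * (1 - n') ^ 2 + 2 * m ^ 2 + 2 * n' ≤ 96 → -6 ≤ n' ∧ n' ≤ 7 ∧ m ^ 2 ≤ 47) ∧
    (∀ n₁ d₁ : ℤ, n₁ ^ 2 * (d₁ - 1) + n₁ ^ 2 * ((4 - d₁) - 1) = 2 * n₁ ^ 2) := by
  refine ⟨fun n' m h => ⟨?_, ?_, ?_⟩, fun n₁ d₁ => by ring⟩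
  · nlinarith [sq_nonneg m, sq_nonneg (n' + 6)]
  · nlinarith [sq_nonneg m, sq_nonneg (n' - 7)]
  · nlinarith [sq_nonneg (2 * n' - 1)]

/-- **[XXXI] 12.3 PROPOSITION S-VOID / 12.1 (the stabiliser of the ribbon twists on a divisorial half; bookkeeping).** `dim ker(·a : H¹(K^{−1}) →
H¹(K^{−1}M₁)) = 3 − h⁰(K²M₁^{−1})` for a non-zero section `a` of `M₁` (Serre duality; multiplication by `a` is injective on `H⁰`): `M₁ = 𝒪`: `3 − 3 = 0` (free,
orbit `3`); `M₁ = K`: `3 − 2 = 1` (orbit `≥ 2`); `M₁ = K²`: `3 − 1 = 2` (orbit `≥ 1`); `deg M₁ ≥ 5`: `3 − 0 = 3` (orbit `0`). S-VOID: no jump along the orbit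
gives `e₁^ι(F) ≥ dim(orbit)`, so orbit `≥ 2` excludes `(0,1)`. [`norm_num` / `omega`] -/
theorem pg18a_stabiliser :
    ((3:ℤ) - 3 = 0 ∧ (3:ℤ) - 0 = 3) ∧ ((3:ℤ) - 2 = 1 ∧ (3:ℤ) - 1 = 2) ∧ ((3:ℤ) - 1 = 2 ∧ (3:ℤ) - 2 = 1) ∧ ((3:ℤ) - 0 = 3 ∧ (3:ℤ) - 3 = 0) ∧
    (∀ e orb : ℤ, 2 ≤ orb → orb ≤ e → e ≠ 1) := by
  refine ⟨by norm_num, by norm_num, by norm_num, by norm_num, fun e orb h1 h2 => by omega⟩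

end ProductGroundEighteenAdd1

end Summit.HodgeConjecture.HodgeConjecture.WeilTypeLadder
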